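import Literature.NumberTheory.Rogawski1990.UnitStableOrbitalIntegralHSideValue     -- ★ L5 (B-p10 g24): the inert-place toolkit (`toPlace`, `galAdicCompletionMap`, residual Frobenius, `𝒪_w`)
import HarnessLib

/-!
# A norm-one sequence `u_N → 1` in `L_w¹` with `|1 − u_N|_w = |ϖ_v|_w^N` at an unramified non-split place (the moving point of `not_rankOneUnstableTransferNonsplit`)

Topic `NumberTheory/Rogawski1990`; namespace `Literature.NumberTheory.Rogawski1990`.  ONE THEOREM (no definition, no instance, no notation, no named fact, no `sorry`).
Cell `pub/hodgecm-mathlib` (D-0151), crux H413 = stmt-HodgeConjecture-24833, line «N6nsGerm»; LEAD F0P3a-plan (g10) WORD T9-1 (1) «NEGATIVE LEMMA → p08 (g14)»; seat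
F0P3a-p08 (g14); helper of FILE B `RankOneUnstableTransferUnguardedObstruction`.  HONEST LABEL: HC_CM is proved only modulo the 2 remaining named inputs (hLiu418, h413)
until rung 0 closes; this file is unconditional local algebra.

THE MATHEMATICS.  `v` unramified in the CM field `L`, `w ∣ v` fixed by `c` (inert).  The residual Frobenius of `L_w ∕ L⁺_v` is non-trivial, so some `a₀ ∈ 𝒪_w` has
`σ_w a₀ − a₀ ∈ 𝒪_wˣ` (★ `exists_isUnit_map_sub_of_residueHom_ne`).  Put `x_N := 1 + ϖ^N a₀` (`ϖ = ϖ_v`, `σ_w ϖ = ϖ`) and `u_N := x_N ∕ σ_w x_N`: then `σ_w(u_N) u_N = 1`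
(`σ_w² = 1`), `1 − u_N = ϖ^N (σ_w a₀ − a₀) ∕ σ_w x_N` has valuation `|ϖ|^N` (`N ≥ 1`), and `u_N → 1` (`ϖ^N a₀ → 0`, ★ `Valued.tendsto_zero_pow_of_v_lt_one`).

* **`exists_normOne_seq`**.

## References
* [LabesseLanglands1979] J.-P. Labesse, R. P. Langlands, *L-indistinguishability for SL(2)*, Canad. J. Math. 31 (1979): §2 (elliptic tori near the centre).
* [Serre1979] J.-P. Serre, *Local Fields*, GTM 67 (1979): Ch. V §2 Prop. 3 (units `1 + 𝔭^N`).
-/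

set_option autoImplicit false

noncomputable section

open NumberField IsDedekindDomain Filter Topology ValuativeRel
open scoped ValuativeRel

namespace Literature.NumberTheory.Rogawski1990

open Literature.NumberTheory.Automorphic Literature.NumberTheory.Automorphic.UnitaryGroup Literature.NumberTheory.GaloisRepresentations

variable (L : Type) [Field L] [NumberField L] [IsCMField L] (v : HeightOneSpectrum (𝓞 ↥(maximalRealSubfield L)))
  (w : PlacesOver L v) (hw : IsCMField.complexConj L • w.1 = w.1)

/-! ## §1 The norm-one sequence `u_N = x_N ∕ σ_w x_N`, `x_N = 1 + ϖ^N a₀` on `L_w` -/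

section Sequence

include hw in
/-- **A NORM-ONE SEQUENCE `u_N → 1` WITH `|1 − u_N|_w = |ϖ_v|_w^N`** at a non-split place `v` unramified in `L`: with `a₀ ∈ 𝒪_w` moved by `σ_w` by a unit (the residual
Frobenius of the inert quadratic extension is non-trivial — ★ `exists_isUnit_map_sub_of_residueHom_ne`), `x_N := 1 + ϖ^N a₀` and `u_N := x_N · (σ_w x_N)⁻¹`:
`σ_w(u_N)·u_N = 1` (`σ_w² = 1`), `1 − u_N = ϖ^N (σ_w a₀ − a₀) ∕ σ_w x_N`, and `ϖ^N a₀ → 0`. [cite: LabesseLanglands1979, §2] [cite: Serre1979, Ch. V §2 Prop. 3] -/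
theorem exists_normOne_seq (hunr : Algebra.IsUnramifiedIn (𝓞 L) v.asIdeal) :
    ∃ u : ℕ → w.1.adicCompletion L,
      (∀ N, galAdicCompletionMap (L := L) (IsCMField.complexConj L) hw (u N) * u N = 1) ∧
      (∀ N, 1 ≤ N → Valued.v (1 - u N) =
        Valued.v ((toPlace v w (HeckeCharacter.uniformizer ↥(maximalRealSubfield L) v : v.adicCompletion ↥(maximalRealSubfield L))) ^ N)) ∧
      Tendsto u atTop (𝓝 1) := by
  classical
  have hc1 : IsCMField.complexConj L ≠ 1 := IsCMField.complexConj_ne_one L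
  set σ := galAdicCompletionMap (L := L) (IsCMField.complexConj L) hw with hσdef
  set ϖ : w.1.adicCompletion L := toPlace v w (HeckeCharacter.uniformizer ↥(maximalRealSubfield L) v : v.adicCompletion ↥(maximalRealSubfield L)) with hϖdef
  have hϖv : Valued.v ϖ = WithZero.exp (-1 : ℤ) := Liu2021.LemD1IndexedNonVacuityInertCofinite.valued_toPlace_uniformizer_of_isUnramifiedIn L v hunr w
  have hϖ1 : Valued.v ϖ < 1 := by rw [hϖv, ← WithZero.exp_zero]; exact WithZero.exp_lt_exp.2 (by norm_num)
  have hσϖ : σ ϖ = ϖ := galAdicCompletionMap_toPlace (IsCMField.complexConj L) w w hw _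
  have hσσ : ∀ x, σ (σ x) = x := fun x => galAdicCompletionMap_galAdicCompletionMap_of_smul_eq (IsCMField.complexConj L) w hc1 hw x
  have hσv : ∀ x, Valued.v (σ x) = Valued.v x := fun x => valued_galAdicCompletionMap (L := L) (IsCMField.complexConj L) hw x
  -- `a₀ ∈ 𝒪_w` with `σ a₀ − a₀` a unit (inert: the residual Frobenius is not the identity)
  have hσO : ∀ x : 𝒪[w.1.adicCompletion L], σ x ∈ 𝒪[w.1.adicCompletion L] := mem_integer_galAdicCompletionMap (IsCMField.complexConj L) v w hw
  obtain ⟨σk, hσk⟩ := exists_residueField_ringHom_galAdicCompletionMap (IsCMField.complexConj L) v w hw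
  have hq : Nat.card 𝓀[w.1.adicCompletion L] = Nat.card (𝓞 ↥(maximalRealSubfield L) ⧸ v.asIdeal) ^ 2 :=
    natCard_residueField_eq_sq_of_inert (IsCMField.complexConj L) v hc1 hunr w hw
  letI : Fintype 𝓀[w.1.adicCompletion L] := Fintype.ofFinite _
  have hq' : Fintype.card 𝓀[w.1.adicCompletion L] = Nat.card (𝓞 ↥(maximalRealSubfield L) ⧸ v.asIdeal) ^ 2 := by rw [← Nat.card_eq_fintype_card, hq]
  obtain ⟨a₀, ha₀⟩ := LocalFields.UnramifiedQuadraticNorm.exists_isUnit_map_sub_of_residueHom_ne σ hσO σk hσk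
    (Literature.LinearAlgebra.Matrix.exists_frob_ne hq' σk (residueHom_galAdicCompletionMap_eq_pow (IsCMField.complexConj L) v hc1 hunr w hw σk hσO hσk))
  -- valuation facts
  have ha₀v : Valued.v (a₀ : w.1.adicCompletion L) ≤ 1 := (v_le_one_iff_mem_integer _).2 a₀.2
  have hda : Valued.v (σ a₀ - a₀) = 1 := by
    have h := (Valuation.integer.integers (valuation (w.1.adicCompletion L))).isUnit_iff_valuation_eq_one.1 ha₀
    exact (v_eq_one_iff_valuation_eq_one _).2 h
  have hxv : ∀ N, 1 ≤ N → Valued.v (ϖ ^ N * a₀) < 1 := by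
    intro N hN
    rw [Valuation.map_mul, Valuation.map_pow]
    calc Valued.v ϖ ^ N * Valued.v (a₀ : w.1.adicCompletion L) ≤ Valued.v ϖ ^ N * 1 := by gcongr
      _ = Valued.v ϖ ^ N := mul_one _
      _ < 1 := pow_lt_one₀ zero_le hϖ1 (by omega)
  have hx1 : ∀ N, 1 ≤ N → Valued.v (1 + ϖ ^ N * a₀) = 1 := fun N hN => Valuation.map_one_add_of_lt _ (hxv N hN)
  have hσx : ∀ N, σ (1 + ϖ ^ N * a₀) = 1 + ϖ ^ N * σ a₀ := fun N => by rw [map_add, map_one, map_mul, map_pow, hσϖ]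
  have hσx1 : ∀ N, 1 ≤ N → Valued.v (σ (1 + ϖ ^ N * a₀)) = 1 := fun N hN => by rw [hσv]; exact hx1 N hN
  have hσx0 : ∀ N, 1 ≤ N → σ (1 + ϖ ^ N * a₀) ≠ 0 := fun N hN h0 => by
    have h := hσx1 N hN; rw [h0, map_zero] at h; exact zero_ne_one h
  -- the sequence (for `N = 0` the same formula; only `N ≥ 1` is used for the valuation clause)
  refine ⟨fun N => (1 + ϖ ^ N * a₀) * (σ (1 + ϖ ^ N * a₀))⁻¹, fun N => ?_, fun N hN => ?_, ?_⟩
  · -- norm one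
    by_cases h0 : σ (1 + ϖ ^ N * a₀) = 0
    · -- then `N = 0` is excluded by nothing, but `σ x = 0` forces `x = 0`, i.e. `ϖ^N a₀ = −1`, of valuation `1`: only possible for `N = 0`;
      -- in that case the element is `0 · 0⁻¹ = 0` and the claim `σ 0 · 0 = 1` fails — so we show `N ≥ 1` is impossible and treat `N = 0` directly.
      exfalso
      have h1 : 1 + ϖ ^ N * (a₀ : w.1.adicCompletion L) = 0 := by
        have := congrArg σ h0; rwa [hσσ, map_zero] at this
      rcases Nat.eq_zero_or_pos N with hN0 | hNpos
      · -- `N = 0`: `1 + a₀ = 0`, so `a₀ = -1` and `σ a₀ - a₀ = 0`, contradicting `hda`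
        rw [hN0, pow_zero, one_mul] at h1
        have ha : (a₀ : w.1.adicCompletion L) = -1 := by linear_combination h1
        have h2 : σ (a₀ : w.1.adicCompletion L) - a₀ = 0 := by rw [ha, map_neg, map_one, sub_self]
        rw [h2, map_zero] at hda
        exact zero_ne_one hda
      · have h := hx1 N hNpos
        rw [h1, map_zero] at h
        exact zero_ne_one h
    · have h1 : 1 + ϖ ^ N * (a₀ : w.1.adicCompletion L) ≠ 0 := fun h1 => h0 (by rw [h1, map_zero])
      rw [map_mul, map_inv₀, hσσ]
      field_simp
  · -- valuation of `1 − u_N`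
    have h0 := hσx0 N hN
    have hsub : 1 - (1 + ϖ ^ N * a₀) * (σ (1 + ϖ ^ N * a₀))⁻¹ = (ϖ ^ N * (σ a₀ - a₀)) * (σ (1 + ϖ ^ N * a₀))⁻¹ := by
      rw [hσx N] at h0 ⊢
      field_simp
      ring
    rw [hsub, Valuation.map_mul, Valuation.map_inv, hσx1 N hN, inv_one, mul_one, Valuation.map_mul, hda, mul_one, Valuation.map_pow]
  · -- the limit: `ϖ^N a₀ → 0`, `σ` continuous, inversion continuous at `1`
    have hpow : Tendsto (fun N : ℕ => ϖ ^ N * (a₀ : w.1.adicCompletion L)) atTop (𝓝 0) := by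
      simpa only [zero_mul] using (Valued.tendsto_zero_pow_of_v_lt_one hϖ1).mul_const (a₀ : w.1.adicCompletion L)
    have hx : Tendsto (fun N : ℕ => 1 + ϖ ^ N * (a₀ : w.1.adicCompletion L)) atTop (𝓝 1) := by
      simpa only [add_zero] using tendsto_const_nhds.add hpow
    have hσc : Continuous σ := continuous_galAdicCompletionMap (L := L) (IsCMField.complexConj L) hw
    have hσx' : Tendsto (fun N : ℕ => σ (1 + ϖ ^ N * (a₀ : w.1.adicCompletion L))) atTop (𝓝 1) := by
      have h := (hσc.tendsto 1).comp hx
      rw [map_one] at h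
      exact h
    have hinv : Tendsto (fun N : ℕ => (σ (1 + ϖ ^ N * (a₀ : w.1.adicCompletion L)))⁻¹) atTop (𝓝 1) := by
      simpa only [inv_one] using hσx'.inv₀ one_ne_zero
    simpa only [mul_one] using hx.mul hinv

end Sequence

end Literature.NumberTheory.Rogawski1990

end
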